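import Summits.QuantumFields.YangMills.Theses.LangevinControlUV
import Summits.QuantumFields.YangMills.Theorems.LatticeGapInUVUnits.Negative.WeakCouplingConcentration

/-!
# Crux `LatticeGapInUVUnits` (stmt-QuantumFields-9366), line `one-ruler`: the shape of a femto package vanishes

Support file for route `LangevinControlUV` of `YangMills` (line `one-ruler`, skeleton
`Cruxes/LatticeGapInUVUnits/Lines/one_ruler.lean` §1; landed by lead c3).  Statements are written out in the route's
own vocabulary (the `let`-body of the femto two-point package shared by `FemtoCurvatureTwoPoint` / `LatticeGapInUVUnits`);
no definition is introduced.

* `package_shape_tendsto_zero` (registered stub) — the shape function of ANY femto two-point package vanishes along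
  its unit map, `Γ(a(β)) → 0`: box `L = 8`, `n = 1` gives `c Γ(a β) ≤ Cov_{β,8}(P₀^{01}, P_{e₂}^{01}) → 0` by
  weak-coupling concentration on the fixed torus (the landed `Negative.tendsto_cov_plaquetteCost`, Disproof §6).
* `upperFemtoBound_of_package` — hence every package is an axis UPPER femto bound with vanishing shape, the input
  the dominating ruler contributes to ruler rigidity (file `…RulerRigidity`).
-/

set_option autoImplicit false

noncomputable section

namespace Summit.QuantumFields.YangMills.Theorems.LatticeGapInUVUnits.OneRuler

open Filter Topology MeasureTheory
open Literature.MathematicalPhysics.QuantumFieldTheory Literature.MathematicalPhysics.QuantumLattice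
open Summit.QuantumFields.YangMills.Theorems.LatticeGapInUVUnits.Negative (tendsto_cov_plaquetteCost zero_lt_one_fin4)

/-- **The shape function of any femto two-point package vanishes along its unit map**: `Γ(a(β)) → 0`
(box `L = 8`, separation `n = 1`: `c Γ(a β) ≤ Cov_{β,8}(P₀^{01}, P_{e₂}^{01}) → 0` by weak-coupling concentration on the
fixed `8⁴` torus).  Only the axis LOWER bound, `0 < c`, `0 < Γ` and `a → 0` are used. -/
theorem package_shape_tendsto_zero : ∀ (G : Type) [Group G] [TopologicalSpace G] [IsTopologicalGroup G] [CompactSpace G] [MeasurableSpace G] [BorelSpace G] (r : LatticeRep G) (a Γ : ℝ → ℝ) (β₀ ℓ₀ c C : ℝ),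
    (0 < ℓ₀ ∧ 0 < c ∧ (∀ β, 0 < a β) ∧ Filter.Tendsto a Filter.atTop (nhds 0) ∧
      (∀ s : ℝ, 0 < s → s ≤ ℓ₀ → 0 < Γ s ∧ Γ s ≤ 1) ∧
      ∀ (L : ℕ) [NeZero L] (β : ℝ), β₀ ≤ β → (L : ℝ) * a β ≤ ℓ₀ →
        let P : (Fin 4 → ZMod L) → Fin 4 → Fin 4 → GaugeConfig 4 L G → ℝ :=
          fun x i j U => (r.N : ℝ) - (r.ρ (plaquetteHolonomy U x i j)).trace.re
        let E : (GaugeConfig 4 L G → ℝ) → ℝ := fun F => wilsonExpectation (d := 4) (L := L) r.ρ β F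
        let cov : (GaugeConfig 4 L G → ℝ) → (GaugeConfig 4 L G → ℝ) → ℝ :=
          fun F F' => E (fun U => F U * F' U) - E F * E F'
        let dist : (Fin 4 → ZMod L) → (Fin 4 → ZMod L) → ℝ :=
          fun x y => Real.sqrt (∑ k : Fin 4, (((x k - y k).valMinAbs : ℤ) : ℝ) ^ 2)
        (∀ n : ℕ, 1 ≤ n → 8 * n ≤ L →
            c * Γ ((n : ℝ) * a β) ≤ (n : ℝ) ^ 8 * cov (P 0 0 1) (P (Pi.single (2 : Fin 4) ((n : ℕ) : ZMod L)) 0 1) ∧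
              (n : ℝ) ^ 8 * cov (P 0 0 1) (P (Pi.single (2 : Fin 4) ((n : ℕ) : ZMod L)) 0 1) ≤ C * Γ ((n : ℝ) * a β)) ∧
          (∀ (x y : Fin 4 → ZMod L) (i j i' j' : Fin 4), x ≠ y → i ≠ j → i' ≠ j' →
            |cov (P x i j) (P y i' j')| * dist x y ^ 8 ≤ C * Γ (dist x y * a β))) →
    Filter.Tendsto (fun β => Γ (a β)) Filter.atTop (nhds 0) := by
  intro G _ _ _ _ _ _ r a Γ β₀ ℓ₀ c C h
  obtain ⟨hℓ, hc, hpos, hlim, hΓ, hbox⟩ := h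
  have hcov0 : Tendsto (fun β : ℝ => (wilsonExpectation (d := 4) (L := 8) r.ρ β (fun U => ((r.N : ℝ) - (r.ρ (plaquetteHolonomy U 0 0 1)).trace.re) *
          ((r.N : ℝ) - (r.ρ (plaquetteHolonomy U (Pi.single (2 : Fin 4) (1 : ZMod 8)) 0 1)).trace.re)) -
        wilsonExpectation (d := 4) (L := 8) r.ρ β (fun U => (r.N : ℝ) - (r.ρ (plaquetteHolonomy U 0 0 1)).trace.re) *
          wilsonExpectation (d := 4) (L := 8) r.ρ β
            (fun U => (r.N : ℝ) - (r.ρ (plaquetteHolonomy U (Pi.single (2 : Fin 4) (1 : ZMod 8)) 0 1)).trace.re))) atTop (𝓝 0) :=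
    tendsto_cov_plaquetteCost r 8 ((0 : Site 4 8), ⟨(0, 1), zero_lt_one_fin4⟩)
      ((Pi.single (2 : Fin 4) (1 : ZMod 8) : Site 4 8), ⟨(0, 1), zero_lt_one_fin4⟩)
  have hev : ∀ᶠ β in atTop, a β < ℓ₀ / 8 := hlim (Iio_mem_nhds (by positivity))
  have hkey : ∀ᶠ β in atTop, 0 ≤ Γ (a β) ∧ Γ (a β) ≤ (wilsonExpectation (d := 4) (L := 8) r.ρ β (fun U => ((r.N : ℝ) - (r.ρ (plaquetteHolonomy U 0 0 1)).trace.re) *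
          ((r.N : ℝ) - (r.ρ (plaquetteHolonomy U (Pi.single (2 : Fin 4) (1 : ZMod 8)) 0 1)).trace.re)) -
        wilsonExpectation (d := 4) (L := 8) r.ρ β (fun U => (r.N : ℝ) - (r.ρ (plaquetteHolonomy U 0 0 1)).trace.re) *
          wilsonExpectation (d := 4) (L := 8) r.ρ β
            (fun U => (r.N : ℝ) - (r.ρ (plaquetteHolonomy U (Pi.single (2 : Fin 4) (1 : ZMod 8)) 0 1)).trace.re)) / c := by
    filter_upwards [hev, eventually_ge_atTop β₀] with β hβ hβ₀
    haveI : NeZero (8 : ℕ) := ⟨by norm_num⟩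
    obtain ⟨hax, -⟩ := hbox 8 β hβ₀ (by push_cast; linarith)
    have h1 := hax 1 le_rfl (by norm_num)
    simp only [Nat.cast_one, one_mul, one_pow] at h1
    have hΓ' := hΓ (a β) (hpos β) (by linarith)
    refine ⟨hΓ'.1.le, ?_⟩
    rw [le_div_iff₀ hc]
    linarith [h1.1]
  refine tendsto_of_tendsto_of_tendsto_of_le_of_le' tendsto_const_nhds ?_
    (hkey.mono fun β h => h.1) (hkey.mono fun β h => h.2)
  simpa using hcov0.div_const c

/-- **Every femto package is an upper femto bound with vanishing shape** (the half of a package that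
`ruler_dominates_of_upper` needs from the DOMINATING ruler). -/
theorem upperFemtoBound_of_package : ∀ (G : Type) [Group G] [TopologicalSpace G] [IsTopologicalGroup G] [CompactSpace G] [MeasurableSpace G] [BorelSpace G] (r : LatticeRep G) (a Γ : ℝ → ℝ) (β₀ ℓ₀ c C : ℝ),
    (0 < ℓ₀ ∧ 0 < c ∧ (∀ β, 0 < a β) ∧ Filter.Tendsto a Filter.atTop (nhds 0) ∧
      (∀ s : ℝ, 0 < s → s ≤ ℓ₀ → 0 < Γ s ∧ Γ s ≤ 1) ∧
      ∀ (L : ℕ) [NeZero L] (β : ℝ), β₀ ≤ β → (L : ℝ) * a β ≤ ℓ₀ →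
        let P : (Fin 4 → ZMod L) → Fin 4 → Fin 4 → GaugeConfig 4 L G → ℝ :=
          fun x i j U => (r.N : ℝ) - (r.ρ (plaquetteHolonomy U x i j)).trace.re
        let E : (GaugeConfig 4 L G → ℝ) → ℝ := fun F => wilsonExpectation (d := 4) (L := L) r.ρ β F
        let cov : (GaugeConfig 4 L G → ℝ) → (GaugeConfig 4 L G → ℝ) → ℝ :=
          fun F F' => E (fun U => F U * F' U) - E F * E F'
        let dist : (Fin 4 → ZMod L) → (Fin 4 → ZMod L) → ℝ :=
          fun x y => Real.sqrt (∑ k : Fin 4, (((x k - y k).valMinAbs : ℤ) : ℝ) ^ 2)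
        (∀ n : ℕ, 1 ≤ n → 8 * n ≤ L →
            c * Γ ((n : ℝ) * a β) ≤ (n : ℝ) ^ 8 * cov (P 0 0 1) (P (Pi.single (2 : Fin 4) ((n : ℕ) : ZMod L)) 0 1) ∧
              (n : ℝ) ^ 8 * cov (P 0 0 1) (P (Pi.single (2 : Fin 4) ((n : ℕ) : ZMod L)) 0 1) ≤ C * Γ ((n : ℝ) * a β)) ∧
          (∀ (x y : Fin 4 → ZMod L) (i j i' j' : Fin 4), x ≠ y → i ≠ j → i' ≠ j' →
            |cov (P x i j) (P y i' j')| * dist x y ^ 8 ≤ C * Γ (dist x y * a β))) →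
    (0 < ℓ₀ ∧ (∀ β, 0 < a β) ∧ Filter.Tendsto a Filter.atTop (nhds 0) ∧ (∀ s : ℝ, 0 < s → s ≤ ℓ₀ → 0 ≤ Γ s) ∧
      Filter.Tendsto (fun β => Γ (a β)) Filter.atTop (nhds 0) ∧
      ∀ (L : ℕ) [NeZero L] (β : ℝ), β₀ ≤ β → (L : ℝ) * a β ≤ ℓ₀ →
        let P : (Fin 4 → ZMod L) → Fin 4 → Fin 4 → GaugeConfig 4 L G → ℝ :=
          fun x i j U => (r.N : ℝ) - (r.ρ (plaquetteHolonomy U x i j)).trace.re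
        let E : (GaugeConfig 4 L G → ℝ) → ℝ := fun F => wilsonExpectation (d := 4) (L := L) r.ρ β F
        let cov : (GaugeConfig 4 L G → ℝ) → (GaugeConfig 4 L G → ℝ) → ℝ :=
          fun F F' => E (fun U => F U * F' U) - E F * E F'
        ∀ n : ℕ, 1 ≤ n → 8 * n ≤ L →
          (n : ℝ) ^ 8 * cov (P 0 0 1) (P (Pi.single (2 : Fin 4) ((n : ℕ) : ZMod L)) 0 1) ≤ C * Γ ((n : ℝ) * a β)) := by
  intro G _ _ _ _ _ _ r a Γ β₀ ℓ₀ c C h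
  have hv := package_shape_tendsto_zero G r a Γ β₀ ℓ₀ c C h
  obtain ⟨hℓ, -, hpos, hlim, hΓ, hbox⟩ := h
  refine ⟨hℓ, hpos, hlim, fun s hs hsl => (hΓ s hs hsl).1.le, hv, fun L _ β hβ hL => ?_⟩
  obtain ⟨hax, -⟩ := hbox L β hβ hL
  exact fun n hn h8 => (hax n hn h8).2

end Summit.QuantumFields.YangMills.Theorems.LatticeGapInUVUnits.OneRuler

end
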